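import Summits.KontsevichZagierPeriods.KontsevichZagierPeriods.Theorems.OctahedralSymmetryLevelFourStuffleInKZStubTransportCubical
import Summits.KontsevichZagierPeriods.KontsevichZagierPeriods.Theorems.OctahedralSymmetryLevelFourStuffleInKZStubTransportSpectator
import Literature.NumberTheory.Transcendental.CyclotomicSimplexRep
import Literature.NumberTheory.Transcendental.KZProductIdeal
import Literature.NumberTheory.Transcendental.KZLogCalculusProofs

/-!
# `ZhaoRelationInKZ` (stmt-KontsevichZagierPeriods-9433), line `Sketch`: the stuffle cube chain (auxiliary)

Auxiliary file of the lead's stub `stub_stuffle` (the series-side half of the finite double shuffle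
block (1)×(1,1) at level 4 inside the Kontsevich–Zagier calculus). Contents:

* poles of the letters `Fin.castSucc m` (`= i^m`) and their products; non-vanishing of
  `u − i^n` for `0 < u < 1`;
* **the pointwise partial fraction** behind Zhao's harmonic product
  `Li₁(x)·Li_{1,1}(y,z) = Σ Li_{1,1,1} + Li_{2,1}(xy,z) + Li_{1,2}(y,xz)` read in CUBE coordinates
  (`stuffle_pointwise`): with `f_p(t) = (t − p)⁻¹`,
  `f_p(u) f_q(v) f_{qr}(vw)·v = f_p(u) f_{pq}(uv) f_{pqr}(uvw)·u²v + f_q(v) f_{pq}(vu) f_{pqr}(vuw)·v²u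
   + f_q(v) f_{qr}(vw) f_{pqr}(vwu)·v²w − f_0(u) f_{pq}(uv) f_{pqr}(uvw)·u²v − f_q(v) f_0(vu) f_{pqr}(vuw)·v²u`
  (a formal identity of rational functions: `field_simp; ring`);
* **the six-term chain** (`stuffle_chain`): for ANY `ℝ`-linear functional `π : ℂ →ₗ[ℝ] ℝ` (the lead
  uses `re` and `im`), a representation `P` on `(0,1) × Δ₂` with integrand
  `π(f_p(t₀) f_q(t₁) f_{qr}(t₂))` is congruent modulo `KZ.relations` to
  `[Q₁] + [Q₂] + [Q₃] − [Q₄] − [Q₅]` for representations `Qᵢ` on `Δ₃` carrying `π` of the five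
  stuffle words `(p,pq,pqr)`, `(q,pq,pqr)`, `(q,qr,pqr)`, `(0,pq,pqr)`, `(q,0,pqr)`: pull `P` back along
  the spectator chart and the `Qᵢ` along the cumulative chart
  (`LevelFourStuffleInKZ.stub_transportSpectator`, `LevelFourStuffleInKZ.stub_transportCubical`
  of the sibling crux — the registered stubs `stub_transportSpectator/Cubical` of this line are
  their aliases; one rule-(2) move each), permute the cube coordinates of `Q₂`, `Q₃`, `Q₅`
  (`KZ.of_sub_of_reindex_mem_relations`), and split `stuffle_pointwise` by rule (1b).

References: J. Zhao, Doc. Math. 15 (2010), §2 Def. 2.4 (the level-`N` stuffle); M. Kontsevich,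
D. Zagier, *Periods* (2001), §1.2.
-/

noncomputable section

open Set MeasureTheory Complex
open Literature.NumberTheory.Transcendental Literature.NumberTheory.Transcendental.KZ

namespace Summit.KontsevichZagierPeriods.OctahedralSymmetry.ZhaoRelationInKZ

/-! ## Poles of the letters `Fin.castSucc m` -/

/-- The pole of the letter `Fin.castSucc m` (`m : Fin 4`) is `i^m`. [cite: Zhao2010, §2] -/
theorem stuffle_levelFourPole_castSucc (m : Fin 4) : levelFourPole (Fin.castSucc m) = I ^ (m : ℕ) := by
  fin_cases m <;> simp [levelFourPole, pow_succ, I_mul_I]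

/-- Poles multiply along `Fin 4`-addition of exponents: `i^{(m+n) mod 4} = i^m · i^n`. [folklore] -/
theorem stuffle_I_pow_fin_add (m n : Fin 4) : I ^ ((m + n : Fin 4) : ℕ) = I ^ (m : ℕ) * I ^ (n : ℕ) := by
  have hmod : ∀ k : ℕ, I ^ k = I ^ (k % 4) := fun k => by
    conv_lhs => rw [← Nat.div_add_mod k 4, pow_add, pow_mul, I_pow_four, one_pow, one_mul]
  rw [Fin.val_add, ← hmod, pow_add]

/-- For `0 < u < 1` and any `n`, `u ≠ i^n` in `ℂ` (norms `u < 1 = ‖i^n‖`). [folklore] -/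
theorem stuffle_ofReal_sub_I_pow_ne_zero (n : ℕ) {u : ℝ} (h0 : 0 < u) (h1 : u < 1) : (u : ℂ) - I ^ n ≠ 0 := by
  intro h
  have h' : (u : ℂ) = I ^ n := sub_eq_zero.mp h
  have hn := congrArg norm h'
  rw [norm_real, Real.norm_eq_abs, abs_of_pos h0, norm_pow, norm_I, one_pow] at hn
  linarith

/-! ## The pointwise partial fraction -/

/-- **Zhao's depth-3 harmonic product as a pointwise identity in cube coordinates.** For complex
`p q r` and real `u v w` with all the displayed denominators non-zero,
`f_p(u) f_q(v) f_{qr}(vw)·v = f_p(u) f_{pq}(uv) f_{pqr}(uvw)·u²v + f_q(v) f_{pq}(vu) f_{pqr}(vuw)·v²u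
 + f_q(v) f_{qr}(vw) f_{pqr}(vwu)·v²w − f_0(u) f_{pq}(uv) f_{pqr}(uvw)·u²v − f_q(v) f_0(vu) f_{pqr}(vuw)·v²u`,
`f_c(t) = (t − c)⁻¹` (a formal identity of rational functions). [cite: Zhao2010, §2 Def. 2.4] -/
theorem stuffle_pointwise (p q r : ℂ) (u v w : ℝ)
    (hu : (u : ℂ) ≠ 0) (hv : (v : ℂ) ≠ 0)
    (h1 : (u : ℂ) - p ≠ 0) (h2 : (v : ℂ) - q ≠ 0) (h3 : (v : ℂ) * w - q * r ≠ 0)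
    (h4 : (u : ℂ) * v - p * q ≠ 0) (h5 : (u : ℂ) * v * w - p * q * r ≠ 0) :
    ((u : ℂ) - p)⁻¹ * (((v : ℂ) - q)⁻¹ * ((v : ℂ) * w - q * r)⁻¹) * v
      = ((u : ℂ) - p)⁻¹ * ((u : ℂ) * v - p * q)⁻¹ * ((u : ℂ) * v * w - p * q * r)⁻¹ * (u ^ 2 * v)
      + ((v : ℂ) - q)⁻¹ * ((v : ℂ) * u - p * q)⁻¹ * ((v : ℂ) * u * w - p * q * r)⁻¹ * (v ^ 2 * u)
      + ((v : ℂ) - q)⁻¹ * ((v : ℂ) * w - q * r)⁻¹ * ((v : ℂ) * w * u - p * q * r)⁻¹ * (v ^ 2 * w)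
      - ((u : ℂ) - 0)⁻¹ * ((u : ℂ) * v - p * q)⁻¹ * ((u : ℂ) * v * w - p * q * r)⁻¹ * (u ^ 2 * v)
      - ((v : ℂ) - q)⁻¹ * ((v : ℂ) * u - 0)⁻¹ * ((v : ℂ) * u * w - p * q * r)⁻¹ * (v ^ 2 * u) := by
  have h4' : (v : ℂ) * u - p * q ≠ 0 := by rwa [mul_comm (v : ℂ)]
  have h5' : (v : ℂ) * u * w - p * q * r ≠ 0 := by rwa [mul_comm (v : ℂ) u]
  have h5'' : (v : ℂ) * w * u - p * q * r ≠ 0 := by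
    rwa [mul_comm ((v : ℂ) * w) u, ← mul_assoc]
  have hvu : (v : ℂ) * u - 0 ≠ 0 := by rw [sub_zero]; exact mul_ne_zero hv hu
  have hu' : (u : ℂ) - 0 ≠ 0 := by rwa [sub_zero]
  field_simp
  ring

/-! ## Geometry of the chart points -/

/-- A cumulative-chart point of the open cube lies in the ordered simplex:
`1 > u > uv > uvw > 0`. [folklore] -/
theorem stuffle_chart_mem_simplex {u v w : ℝ} (hu : u ∈ Ioo (0 : ℝ) 1) (hv : v ∈ Ioo (0 : ℝ) 1)
    (hw : w ∈ Ioo (0 : ℝ) 1) :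
    (![u, u * v, u * v * w] : Fin 3 → ℝ) ∈
      {t : Fin 3 → ℝ | 1 > t 0 ∧ t 0 > t 1 ∧ t 1 > t 2 ∧ t 2 > 0} := by
  simp only [mem_setOf_eq, Matrix.cons_val_zero, Matrix.cons_val_one, Matrix.head_cons,
    Matrix.cons_val_two, Matrix.tail_cons]
  refine ⟨hu.2, ?_, ?_, ?_⟩
  · exact mul_lt_of_lt_one_right hu.1 hv.2
  · exact mul_lt_of_lt_one_right (mul_pos hu.1 hv.1) hw.2
  · exact mul_pos (mul_pos hu.1 hv.1) hw.1

/-- A spectator-chart point of the open cube lies in `(0,1) × Δ₂`. [folklore] -/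
theorem stuffle_spectator_mem_prod {u v w : ℝ} (hu : u ∈ Ioo (0 : ℝ) 1) (hv : v ∈ Ioo (0 : ℝ) 1)
    (hw : w ∈ Ioo (0 : ℝ) 1) :
    (![u, v, v * w] : Fin 3 → ℝ) ∈
      {t : Fin 3 → ℝ | (0 < t 0 ∧ t 0 < 1) ∧ 1 > t 1 ∧ t 1 > t 2 ∧ t 2 > 0} := by
  simp only [mem_setOf_eq, Matrix.cons_val_zero, Matrix.cons_val_one, Matrix.head_cons,
    Matrix.cons_val_two, Matrix.tail_cons]
  exact ⟨⟨hu.1, hu.2⟩, hv.2, mul_lt_of_lt_one_right hv.1 hw.2, mul_pos hv.1 hw.1⟩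

/-- The open cube is invariant under a permutation of the coordinates: the reindexed domain is
the cube again. [folklore] -/
theorem stuffle_setOf_comp_mem_cube (e : Fin 3 ≃ Fin 3) :
    {w : Fin 3 → ℝ | (fun i => w (e i)) ∈ {s : Fin 3 → ℝ | ∀ i, s i ∈ Ioo (0 : ℝ) 1}} =
      {s : Fin 3 → ℝ | ∀ i, s i ∈ Ioo (0 : ℝ) 1} := by
  ext w
  simp only [mem_setOf_eq]
  constructor
  · intro h i
    simpa using h (e.symm i)
  · intro h i
    exact h (e i)

/-! ## The six-term chain -/

/-- A scalar Jacobian factor passes inside an `ℝ`-linear functional: `π z · a = π (a · z)`.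
[folklore] -/
theorem stuffle_linear_apply_mul_real (π : ℂ →ₗ[ℝ] ℝ) (z : ℂ) (a : ℝ) : π z * a = π ((a : ℂ) * z) := by
  rw [← Complex.real_smul, map_smul, smul_eq_mul, mul_comm]

/-- **The stuffle (1)×(1,1) as a six-term chain of moves.** Let `π : ℂ →ₗ[ℝ] ℝ` be `ℝ`-linear,
`x y z : Fin 4` with poles `p = i^x`, `q = i^y`, `r = i^z`. If `P` lives on `(0,1) × Δ₂` with
integrand `π(f_p(t₀) f_q(t₁) f_{qr}(t₂))` and `Q₁,…,Q₅` live on `Δ₃` with integrands `π` of the word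
integrands of `(p,pq,pqr)`, `(q,pq,pqr)`, `(q,qr,pqr)`, `(0,pq,pqr)`, `(q,0,pqr)`, then
`[P] − ([Q₁] + [Q₂] + [Q₃] − [Q₄] − [Q₅]) ∈ KZ.relations`: two monomial-chart transports
(`LevelFourStuffleInKZ.stub_transportSpectator/Cubical`), the coordinate
permutations `(0 1)` on
`Q₂`, `Q₅` and `(0 1 2)` on `Q₃` (`KZ.of_sub_of_reindex_mem_relations`), and the pointwise identity
`stuffle_pointwise` split by integrand additivity. [cite: Zhao2010, §2 Def. 2.4] -/
theorem stuffle_chain (π : ℂ →ₗ[ℝ] ℝ) (x y z : Fin 4)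
    (P : IntegralRep 3) (hPd : P.domain = {t | (0 < t 0 ∧ t 0 < 1) ∧ 1 > t 1 ∧ t 1 > t 2 ∧ t 2 > 0})
    (hPi : ∀ t ∈ P.domain, P.integrand t = π (levelFourFactor (Fin.castSucc x) (t 0) *
      (levelFourFactor (Fin.castSucc y) (t 1) * levelFourFactor (Fin.castSucc (y + z)) (t 2))))
    (Q₁ Q₂ Q₃ Q₄ Q₅ : IntegralRep 3)
    (hQ₁d : Q₁.domain = {t | 1 > t 0 ∧ t 0 > t 1 ∧ t 1 > t 2 ∧ t 2 > 0})
    (hQ₂d : Q₂.domain = {t | 1 > t 0 ∧ t 0 > t 1 ∧ t 1 > t 2 ∧ t 2 > 0})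
    (hQ₃d : Q₃.domain = {t | 1 > t 0 ∧ t 0 > t 1 ∧ t 1 > t 2 ∧ t 2 > 0})
    (hQ₄d : Q₄.domain = {t | 1 > t 0 ∧ t 0 > t 1 ∧ t 1 > t 2 ∧ t 2 > 0})
    (hQ₅d : Q₅.domain = {t | 1 > t 0 ∧ t 0 > t 1 ∧ t 1 > t 2 ∧ t 2 > 0})
    (hQ₁ : ∀ t ∈ Q₁.domain, Q₁.integrand t = π (levelFourFactor (Fin.castSucc x) (t 0) *
      levelFourFactor (Fin.castSucc (x + y)) (t 1) * levelFourFactor (Fin.castSucc (x + y + z)) (t 2)))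
    (hQ₂ : ∀ t ∈ Q₂.domain, Q₂.integrand t = π (levelFourFactor (Fin.castSucc y) (t 0) *
      levelFourFactor (Fin.castSucc (x + y)) (t 1) * levelFourFactor (Fin.castSucc (x + y + z)) (t 2)))
    (hQ₃ : ∀ t ∈ Q₃.domain, Q₃.integrand t = π (levelFourFactor (Fin.castSucc y) (t 0) *
      levelFourFactor (Fin.castSucc (y + z)) (t 1) * levelFourFactor (Fin.castSucc (x + y + z)) (t 2)))
    (hQ₄ : ∀ t ∈ Q₄.domain, Q₄.integrand t = π (levelFourFactor 4 (t 0) *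
      levelFourFactor (Fin.castSucc (x + y)) (t 1) * levelFourFactor (Fin.castSucc (x + y + z)) (t 2)))
    (hQ₅ : ∀ t ∈ Q₅.domain, Q₅.integrand t = π (levelFourFactor (Fin.castSucc y) (t 0) *
      levelFourFactor 4 (t 1) * levelFourFactor (Fin.castSucc (x + y + z)) (t 2))) :
    of P - (of Q₁ + of Q₂ + of Q₃ - of Q₄ - of Q₅) ∈ relations := by
  -- the transports to the open cube
  obtain ⟨Pt, hPtd, hPti, hPte⟩ := LevelFourStuffleInKZ.stub_transportSpectator P hPd
  obtain ⟨Q₁t, hQ₁td, hQ₁ti, hQ₁te⟩ := LevelFourStuffleInKZ.stub_transportCubical Q₁ hQ₁d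
  obtain ⟨Q₂t, hQ₂td, hQ₂ti, hQ₂te⟩ := LevelFourStuffleInKZ.stub_transportCubical Q₂ hQ₂d
  obtain ⟨Q₃t, hQ₃td, hQ₃ti, hQ₃te⟩ := LevelFourStuffleInKZ.stub_transportCubical Q₃ hQ₃d
  obtain ⟨Q₄t, hQ₄td, hQ₄ti, hQ₄te⟩ := LevelFourStuffleInKZ.stub_transportCubical Q₄ hQ₄d
  obtain ⟨Q₅t, hQ₅td, hQ₅ti, hQ₅te⟩ := LevelFourStuffleInKZ.stub_transportCubical Q₅ hQ₅d
  -- the two cube permutations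
  set τ : Fin 3 ≃ Fin 3 := Equiv.swap 0 1 with hτ
  set γ : Fin 3 ≃ Fin 3 := finRotate 3 with hγ
  have hτ0 : τ 0 = 1 := by simp [hτ]
  have hτ1 : τ 1 = 0 := by simp [hτ]
  have hτ2 : τ 2 = 2 := by rw [hτ, Equiv.swap_apply_of_ne_of_ne] <;> decide
  have hγ0 : γ 0 = 1 := by simp [hγ]
  have hγ1 : γ 1 = 2 := by simp [hγ]
  have hγ2 : γ 2 = 0 := by simp [hγ]
  have hR₂ : of Q₂t - of (Q₂t.reindex τ) ∈ relations := of_sub_of_reindex_mem_relations Q₂t τ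
  have hR₃ : of Q₃t - of (Q₃t.reindex γ) ∈ relations := of_sub_of_reindex_mem_relations Q₃t γ
  have hR₅ : of Q₅t - of (Q₅t.reindex τ) ∈ relations := of_sub_of_reindex_mem_relations Q₅t τ
  -- integrand additivity on the cube: `Pt = Q₁t + Q₂t∘τ + Q₃t∘γ − Q₄t − Q₅t∘τ`
  have hadd : of Pt - of Q₁t - ∑ i : Fin 4,
      of ((![Q₂t.reindex τ, Q₃t.reindex γ, Q₄t.neg, (Q₅t.reindex τ).neg] : Fin 4 → IntegralRep 3) i)
        ∈ relations := by
    refine of_sub_of_sub_sum_mem_relations 4 Pt Q₁t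
      ![Q₂t.reindex τ, Q₃t.reindex γ, Q₄t.neg, (Q₅t.reindex τ).neg] (by rw [hQ₁td, hPtd]) ?_ ?_
    · intro i
      fin_cases i
      · simpa [hPtd, hQ₂td] using stuffle_setOf_comp_mem_cube τ
      · simpa [hPtd, hQ₃td] using stuffle_setOf_comp_mem_cube γ
      · simp [hPtd, hQ₄td]
      · simpa [hPtd, hQ₅td] using stuffle_setOf_comp_mem_cube τ
    · intro s hs
      rw [hPtd] at hs
      have hs' : ∀ i, s i ∈ Ioo (0 : ℝ) 1 := hs
      have h0 := hs' 0
      have h1 := hs' 1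
      have h2 := hs' 2
      -- the permuted points are in the cube
      have hsτ : (fun i => s (τ i)) ∈ {s : Fin 3 → ℝ | ∀ i, s i ∈ Ioo (0 : ℝ) 1} := fun i => hs' _
      have hsγ : (fun i => s (γ i)) ∈ {s : Fin 3 → ℝ | ∀ i, s i ∈ Ioo (0 : ℝ) 1} := fun i => hs' _
      simp only [Fin.sum_univ_four, Matrix.cons_val_zero, Matrix.cons_val_one, Matrix.head_cons,
        Matrix.cons_val_two, Matrix.tail_cons, Matrix.cons_val_three, IntegralRep.integrand_neg,
        Pi.neg_apply, IntegralRep.reindex_integrand]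
      rw [hPti s hs, hQ₁ti s hs, hQ₂ti _ hsτ, hQ₃ti _ hsγ, hQ₄ti s hs, hQ₅ti _ hsτ]
      simp only [hτ0, hτ1, hτ2, hγ0, hγ1, hγ2]
      rw [hPi _ (hPd ▸ stuffle_spectator_mem_prod h0 h1 h2), hQ₁ _ (hQ₁d ▸ stuffle_chart_mem_simplex h0 h1 h2),
        hQ₂ _ (hQ₂d ▸ stuffle_chart_mem_simplex h1 h0 h2), hQ₃ _ (hQ₃d ▸ stuffle_chart_mem_simplex h1 h2 h0),
        hQ₄ _ (hQ₄d ▸ stuffle_chart_mem_simplex h0 h1 h2), hQ₅ _ (hQ₅d ▸ stuffle_chart_mem_simplex h1 h0 h2)]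
      simp only [Matrix.cons_val_zero, Matrix.cons_val_one, Matrix.head_cons, Matrix.cons_val_two,
        Matrix.tail_cons, stuffle_linear_apply_mul_real, ← map_add, ← map_neg]
      congr 1
      -- the complex identity
      simp only [levelFourFactor_eq, stuffle_levelFourPole_castSucc, stuffle_I_pow_fin_add,
        show levelFourPole 4 = 0 from rfl]
      push_cast
      have hu : (s 0 : ℂ) ≠ 0 := by exact_mod_cast h0.1.ne'
      have hv : (s 1 : ℂ) ≠ 0 := by exact_mod_cast h1.1.ne'
      have e1 : (s 0 : ℂ) - I ^ (x : ℕ) ≠ 0 := stuffle_ofReal_sub_I_pow_ne_zero _ h0.1 h0.2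
      have e2 : (s 1 : ℂ) - I ^ (y : ℕ) ≠ 0 := stuffle_ofReal_sub_I_pow_ne_zero _ h1.1 h1.2
      have e3 : (s 1 : ℂ) * (s 2) - I ^ (y : ℕ) * I ^ (z : ℕ) ≠ 0 := by
        rw [← pow_add]
        have := stuffle_ofReal_sub_I_pow_ne_zero ((y : ℕ) + z) (mul_pos h1.1 h2.1)
          (mul_lt_one_of_nonneg_of_lt_one_left h1.1.le h1.2 h2.2.le)
        push_cast at this
        exact this
      have e4 : (s 0 : ℂ) * (s 1) - I ^ (x : ℕ) * I ^ (y : ℕ) ≠ 0 := by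
        rw [← pow_add]
        have := stuffle_ofReal_sub_I_pow_ne_zero ((x : ℕ) + y) (mul_pos h0.1 h1.1)
          (mul_lt_one_of_nonneg_of_lt_one_left h0.1.le h0.2 h1.2.le)
        push_cast at this
        exact this
      have e5 : (s 0 : ℂ) * (s 1) * (s 2) - I ^ (x : ℕ) * I ^ (y : ℕ) * I ^ (z : ℕ) ≠ 0 := by
        rw [← pow_add, ← pow_add]
        have := stuffle_ofReal_sub_I_pow_ne_zero ((x : ℕ) + y + z) (mul_pos (mul_pos h0.1 h1.1) h2.1)
          (mul_lt_one_of_nonneg_of_lt_one_left (mul_pos h0.1 h1.1).le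
            (mul_lt_one_of_nonneg_of_lt_one_left h0.1.le h0.2 h1.2.le) h2.2.le)
        push_cast at this
        exact this
      have key := stuffle_pointwise (I ^ (x : ℕ)) (I ^ (y : ℕ)) (I ^ (z : ℕ)) (s 0) (s 1) (s 2)
        hu hv e1 e2 e3 e4 e5
      linear_combination key
  -- negatives
  have hn₄ : of Q₄t + of Q₄t.neg ∈ relations :=
    of_add_of_mem_relations_of_eqOn_neg rfl fun _ _ => rfl
  have hn₅ : of (Q₅t.reindex τ) + of (Q₅t.reindex τ).neg ∈ relations :=
    of_add_of_mem_relations_of_eqOn_neg rfl fun _ _ => rfl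
  -- assembly
  simp only [Fin.sum_univ_four, Matrix.cons_val_zero, Matrix.cons_val_one, Matrix.head_cons,
    Matrix.cons_val_two, Matrix.tail_cons, Matrix.cons_val_three] at hadd
  have key : of P - (of Q₁ + of Q₂ + of Q₃ - of Q₄ - of Q₅) =
      -(of Pt - of P) +
      (of Pt - of Q₁t - (of (Q₂t.reindex τ) + of (Q₃t.reindex γ) + of Q₄t.neg + of (Q₅t.reindex τ).neg)) +
      (of Q₁t - of Q₁) +
      ((of Q₂t - of Q₂) - (of Q₂t - of (Q₂t.reindex τ))) +
      ((of Q₃t - of Q₃) - (of Q₃t - of (Q₃t.reindex γ))) +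
      ((of Q₄t + of Q₄t.neg) - (of Q₄t - of Q₄)) +
      ((of (Q₅t.reindex τ) + of (Q₅t.reindex τ).neg) + (of Q₅t - of (Q₅t.reindex τ)) -
        (of Q₅t - of Q₅)) := by
    abel
  rw [key]
  refine relations.add_mem (relations.add_mem (relations.add_mem (relations.add_mem
    (relations.add_mem (relations.add_mem (relations.neg_mem hPte) hadd) hQ₁te)
    (relations.sub_mem hQ₂te hR₂)) (relations.sub_mem hQ₃te hR₃))
    (relations.sub_mem hn₄ hQ₄te)) ?_
  exact relations.sub_mem (relations.add_mem hn₅ hR₅) hQ₅te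

end Summit.KontsevichZagierPeriods.OctahedralSymmetry.ZhaoRelationInKZ

end
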